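import Literature.Analysis.FluidPDE.SelfSimilar
import Literature.Analysis.FluidPDE.SelfSimilarProofs
import Literature.Analysis.FluidPDE.SpaceTimeRescaling
import Literature.Analysis.FluidPDE.LocalTypeI
import Literature.Analysis.UnboundedOperators.HeatKernel
import HarnessLib

/-!
# Crux `RecurrentLiouville` (stmt-NavierStokesRegularity-1589), line `Sketch` (v6, Giga–Kohn harvest) —
# action tools: weighted window increments ≤ the Gaussian scaling action; local ≤ weighted

Theorems-only file (no definitions, no named facts).  The Gaussian SCALING ACTION of a field `u`
(of class `C¹` on the open slab) on a backward window `(a, b) ⊆ (-∞, 0)` is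
`∫_{(a,b)×ℝ³} ‖Z u(t,x)‖² K(−t, x) dx dt`, `Z u = ½u + D(uncurry u)(t,x)[(t, x/2)] = ½u + ½(x·∇)u + t∂ₜu`
the scaling defect (`d/dc|_{c=1} c u(c²t, cx) = 2 Z u`), `K` the heat kernel; it is scale invariant
and vanishes exactly on self-similar windows (strategist census §3 S3, `HarvestGigaKohnAction.lean`).

* `gkSWR_weighted_le_action_of` — from the line's stubs S2a (`stub_gkScalingCurve`: FTC +
  Cauchy–Schwarz along the scaling curve) and S2b (`stub_gkWeightedTransport`: Tonelli + parabolic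
  change of variables), taken as HYPOTHESES `hS2a`, `hS2b` (both are registered stubs of the line;
  the consumer feeds the landed theorems): for `u` of class `C¹` on the open slab, `t₀ < 0`,
  `1 ≤ c`, `c² ≤ 2`, the Gaussian-weighted orbit increment on `(2t₀,t₀) × ℝ³` is `≤` the action on
  `(4t₀, t₀)` (constant `4(c−1)² ≤ 1`).
* `gkSWR_local_le_weighted` — at scale `λ`: the plain `L²` increment on the box
  `(−2λ², −λ²) × B_{λR}` is `≤ (λ³/m₀) ×` the weighted one, `m₀ = (8π)^{-3/2} e^{-R²/4}` (the
  Gaussian is bounded below on the normalised box and parabolically self-similar).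
* `stub_gkActionTools` — registered tools stub (conjunction of the two).

## References

* Y. Giga, R. V. Kohn, Comm. Pure Appl. Math. 38 (1985) 297–319. [GigaKohn1985]
* T.-P. Tsai, Arch. Rational Mech. Anal. 143 (1998), Thm 1. [Tsai1998]
* D. Albritton, T. Barker, J. Math. Fluid Mech. 21 (2019), Lemma 2.2, Prop. 2.3. [AlbrittonBarker2019]
-/

noncomputable section

-- the sub-problem namespace repeats the summit name (D-0017 layout `Summit.<S>.<P>.Theorems`)
set_option linter.dupNamespace false

namespace Summit.NavierStokesRegularity.NavierStokesRegularity.Theorems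

open MeasureTheory Set Function Filter Topology TopologicalSpace Metric
open Literature.Analysis Literature.Analysis.FluidPDE
open scoped NNReal ENNReal

/-! ### The statements of the stubs used as hypotheses (abbreviated through `type_of%` is not
available for unlanded stubs, so they are spelled out as `Prop`-valued binders below) -/

/-- Twice the scaling defect: `u + D(uncurry u)[(2τ, y)] = 2 • (½u + D(uncurry u)[(τ, y/2)])`, so the
squared norms differ by the factor `4`. [folklore] -/
theorem gkSWR_integrand_eq (u : ℝ → EuclideanSpace ℝ (Fin 3) → EuclideanSpace ℝ (Fin 3))
    (w : ℝ × EuclideanSpace ℝ (Fin 3)) :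
    ‖u w.1 w.2 + fderiv ℝ (uncurry u) w (2 * w.1, w.2)‖ₑ ^ 2 =
      4 * ‖(2 : ℝ)⁻¹ • u w.1 w.2 + fderiv ℝ (uncurry u) w (w.1, (2 : ℝ)⁻¹ • w.2)‖ₑ ^ 2 := by
  have hv : ((2 * w.1, w.2) : ℝ × EuclideanSpace ℝ (Fin 3)) =
      (2 : ℝ) • ((w.1, (2 : ℝ)⁻¹ • w.2) : ℝ × EuclideanSpace ℝ (Fin 3)) := by
    ext <;> simp [smul_smul]
  have h2 : u w.1 w.2 + fderiv ℝ (uncurry u) w (2 * w.1, w.2) =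
      (2 : ℝ) • ((2 : ℝ)⁻¹ • u w.1 w.2 + fderiv ℝ (uncurry u) w (w.1, (2 : ℝ)⁻¹ • w.2)) := by
    rw [hv, map_smul, smul_add, smul_smul]
    norm_num
  rw [h2, enorm_smul, mul_pow]
  congr 1
  rw [show ‖(2 : ℝ)‖ₑ = 2 by simp [Real.enorm_eq_ofReal_abs]]
  norm_num

/-! ### Continuity of the action integrand on the open slab -/

/-- For `u` of class `C¹` on the open slab, `w ↦ ‖u(w) + D(uncurry u)(w)[(2w₁, w₂)]‖ₑ²` is
continuous there (as an `ℝ≥0∞`-valued function). [folklore] -/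
theorem gkSWR_continuousOn_integrand {u : ℝ → EuclideanSpace ℝ (Fin 3) → EuclideanSpace ℝ (Fin 3)}
    (hsm : ContDiffOn ℝ 1 (uncurry u) (Iio (0 : ℝ) ×ˢ univ)) :
    ContinuousOn (fun w : ℝ × EuclideanSpace ℝ (Fin 3) =>
      ‖u w.1 w.2 + fderiv ℝ (uncurry u) w (2 * w.1, w.2)‖ₑ ^ 2) (Iio (0 : ℝ) ×ˢ univ) := by
  have hopen : IsOpen (Iio (0 : ℝ) ×ˢ (univ : Set (EuclideanSpace ℝ (Fin 3)))) :=
    isOpen_Iio.prod isOpen_univ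
  have h1 : ContinuousOn (uncurry u) (Iio (0 : ℝ) ×ˢ univ) := hsm.continuousOn
  have h2 : ContinuousOn (fderiv ℝ (uncurry u)) (Iio (0 : ℝ) ×ˢ univ) :=
    hsm.continuousOn_fderiv_of_isOpen hopen le_rfl
  have h3 : ContinuousOn (fun w : ℝ × EuclideanSpace ℝ (Fin 3) =>
      fderiv ℝ (uncurry u) w (2 * w.1, w.2)) (Iio (0 : ℝ) ×ˢ univ) :=
    h2.clm_apply ((continuous_const.mul continuous_fst).prodMk continuous_snd).continuousOn
  have h4 : ContinuousOn (fun w : ℝ × EuclideanSpace ℝ (Fin 3) =>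
      u w.1 w.2 + fderiv ℝ (uncurry u) w (2 * w.1, w.2)) (Iio (0 : ℝ) ×ˢ univ) := h1.add h3
  exact ((ENNReal.continuous_pow 2).comp continuous_enorm).comp_continuousOn h4

/-! ### Weighted window increments are bounded by the action (from S2a and S2b) -/

/-- **Gaussian-weighted window increments ≤ the scaling action** (from the stubs S2a, S2b taken as
hypotheses `hS2a`, `hS2b`).  For `u` of class `C¹` on the open slab, `t₀ < 0` and `1 ≤ c`, `c² ≤ 2`:
`∫_{(2t₀,t₀)×ℝ³} ‖c u(c²t,cx) − u(t,x)‖² K(−t,x) ≤ 4(c−1)² · ∫_{(4t₀,t₀)×ℝ³} ‖Z u‖² K ≤ action`.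
[cite: GigaKohn1985, §2 (weighted energy)] -/
theorem gkSWR_weighted_le_action_of
    (hS2a : ∀ (u : ℝ → EuclideanSpace ℝ (Fin 3) → EuclideanSpace ℝ (Fin 3)),
      ContDiffOn ℝ 1 (uncurry u) (Iio (0 : ℝ) ×ˢ univ) →
      ∀ (t : ℝ), t < 0 → ∀ (x : EuclideanSpace ℝ (Fin 3)) (c : ℝ), 1 ≤ c →
        ‖nsRescale c u t x - u t x‖ₑ ^ 2 ≤
          ENNReal.ofReal (c - 1) * ∫⁻ ς in Icc (1 : ℝ) c,
            ‖u (ς ^ 2 * t) (ς • x) +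
              fderiv ℝ (uncurry u) (ς ^ 2 * t, ς • x) (2 * (ς ^ 2 * t), ς • x)‖ₑ ^ 2)
    (hS2b : ∀ (F : ℝ × EuclideanSpace ℝ (Fin 3) → ℝ≥0∞), ContinuousOn F (Iio (0 : ℝ) ×ˢ univ) →
      ∀ (t₀ : ℝ), t₀ < 0 → ∀ c : ℝ, 1 ≤ c → c ^ 2 ≤ 2 →
        ∫⁻ z in Ioo (2 * t₀) t₀ ×ˢ (univ : Set (EuclideanSpace ℝ (Fin 3))),
            (∫⁻ ς in Icc (1 : ℝ) c, F (ς ^ 2 * z.1, ς • z.2)) *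
              ENNReal.ofReal (UnboundedOperators.heatKernel (-z.1) z.2) ≤
          ENNReal.ofReal (c - 1) *
            ∫⁻ z in Ioo (4 * t₀) t₀ ×ˢ (univ : Set (EuclideanSpace ℝ (Fin 3))),
              F z * ENNReal.ofReal (UnboundedOperators.heatKernel (-z.1) z.2))
    {u : ℝ → EuclideanSpace ℝ (Fin 3) → EuclideanSpace ℝ (Fin 3)}
    (hsm : ContDiffOn ℝ 1 (uncurry u) (Iio (0 : ℝ) ×ˢ univ)) {t₀ : ℝ} (ht₀ : t₀ < 0)
    {c : ℝ} (hc1 : 1 ≤ c) (hc2 : c ^ 2 ≤ 2) :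
    ∫⁻ z in Ioo (2 * t₀) t₀ ×ˢ (univ : Set (EuclideanSpace ℝ (Fin 3))),
        ‖nsRescale c u z.1 z.2 - u z.1 z.2‖ₑ ^ 2 *
          ENNReal.ofReal (UnboundedOperators.heatKernel (-z.1) z.2) ≤
      ∫⁻ z in Ioo (4 * t₀) t₀ ×ˢ (univ : Set (EuclideanSpace ℝ (Fin 3))),
        ‖(2 : ℝ)⁻¹ • u z.1 z.2 + fderiv ℝ (uncurry u) z (z.1, (2 : ℝ)⁻¹ • z.2)‖ₑ ^ 2 *
          ENNReal.ofReal (UnboundedOperators.heatKernel (-z.1) z.2) := by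
  set F : ℝ × EuclideanSpace ℝ (Fin 3) → ℝ≥0∞ := fun w =>
    ‖u w.1 w.2 + fderiv ℝ (uncurry u) w (2 * w.1, w.2)‖ₑ ^ 2 with hF
  have hFc : ContinuousOn F (Iio (0 : ℝ) ×ˢ univ) := gkSWR_continuousOn_integrand hsm
  -- pointwise bound on the window (S2a), integrated against the kernel
  have hmeas : MeasurableSet (Ioo (2 * t₀) t₀ ×ˢ (univ : Set (EuclideanSpace ℝ (Fin 3)))) :=
    measurableSet_Ioo.prod MeasurableSet.univ
  have step1 : ∫⁻ z in Ioo (2 * t₀) t₀ ×ˢ (univ : Set (EuclideanSpace ℝ (Fin 3))),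
        ‖nsRescale c u z.1 z.2 - u z.1 z.2‖ₑ ^ 2 *
          ENNReal.ofReal (UnboundedOperators.heatKernel (-z.1) z.2) ≤
      ∫⁻ z in Ioo (2 * t₀) t₀ ×ˢ (univ : Set (EuclideanSpace ℝ (Fin 3))),
        ENNReal.ofReal (c - 1) * ((∫⁻ ς in Icc (1 : ℝ) c, F (ς ^ 2 * z.1, ς • z.2)) *
          ENNReal.ofReal (UnboundedOperators.heatKernel (-z.1) z.2)) := by
    refine lintegral_mono_ae ((ae_restrict_mem hmeas).mono fun z hz => ?_)
    have hz1 : z.1 < 0 := (mem_prod.1 hz).1.2.trans ht₀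
    have h := hS2a u hsm z.1 hz1 z.2 c hc1
    calc ‖nsRescale c u z.1 z.2 - u z.1 z.2‖ₑ ^ 2 *
          ENNReal.ofReal (UnboundedOperators.heatKernel (-z.1) z.2)
        ≤ (ENNReal.ofReal (c - 1) * ∫⁻ ς in Icc (1 : ℝ) c, F (ς ^ 2 * z.1, ς • z.2)) *
          ENNReal.ofReal (UnboundedOperators.heatKernel (-z.1) z.2) := by gcongr
      _ = _ := by ring
  refine step1.trans ?_
  rw [lintegral_const_mul' _ _ ENNReal.ofReal_ne_top]
  -- transport (S2b)
  have step2 := hS2b F hFc t₀ ht₀ c hc1 hc2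
  refine (mul_le_mul' le_rfl step2).trans ?_
  -- the integrand is `4 ‖Z u‖²`, and `4 (c-1)² ≤ 1`
  have hF4 : ∀ z : ℝ × EuclideanSpace ℝ (Fin 3),
      F z * ENNReal.ofReal (UnboundedOperators.heatKernel (-z.1) z.2) =
        4 * (‖(2 : ℝ)⁻¹ • u z.1 z.2 + fderiv ℝ (uncurry u) z (z.1, (2 : ℝ)⁻¹ • z.2)‖ₑ ^ 2 *
          ENNReal.ofReal (UnboundedOperators.heatKernel (-z.1) z.2)) := fun z => by
    simp only [hF]
    rw [gkSWR_integrand_eq u z, mul_assoc]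
  simp_rw [hF4]
  rw [lintegral_const_mul' _ _ (by norm_num : (4 : ℝ≥0∞) ≠ ⊤), ← mul_assoc, ← mul_assoc]
  have hconst : ENNReal.ofReal (c - 1) * ENNReal.ofReal (c - 1) * 4 ≤ 1 := by
    rw [← ENNReal.ofReal_mul (by linarith), show (4 : ℝ≥0∞) = ENNReal.ofReal 4 by norm_num,
      ← ENNReal.ofReal_mul (by nlinarith), ← ENNReal.ofReal_one]
    refine ENNReal.ofReal_le_ofReal ?_
    have hc15 : c ≤ 3 / 2 := by nlinarith
    nlinarith
  calc ENNReal.ofReal (c - 1) * ENNReal.ofReal (c - 1) * 4 *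
        ∫⁻ z in Ioo (4 * t₀) t₀ ×ˢ (univ : Set (EuclideanSpace ℝ (Fin 3))),
          ‖(2 : ℝ)⁻¹ • u z.1 z.2 + fderiv ℝ (uncurry u) z (z.1, (2 : ℝ)⁻¹ • z.2)‖ₑ ^ 2 *
            ENNReal.ofReal (UnboundedOperators.heatKernel (-z.1) z.2)
      ≤ 1 * ∫⁻ z in Ioo (4 * t₀) t₀ ×ˢ (univ : Set (EuclideanSpace ℝ (Fin 3))),
          ‖(2 : ℝ)⁻¹ • u z.1 z.2 + fderiv ℝ (uncurry u) z (z.1, (2 : ℝ)⁻¹ • z.2)‖ₑ ^ 2 *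
            ENNReal.ofReal (UnboundedOperators.heatKernel (-z.1) z.2) := by gcongr
    _ = _ := one_mul _

/-! ### The Gaussian weight is bounded below on the normalised box -/

/-- On `t ∈ (−2,−1)`, `‖x‖ < R`: `(8π)^{-3/2} e^{-R²/4} ≤ K(−t, x)`. [folklore] -/
theorem gkSWR_kernel_lower {R t : ℝ} (ht : t ∈ Ioo (-2 : ℝ) (-1)) {x : EuclideanSpace ℝ (Fin 3)}
    (hx : x ∈ Metric.ball (0 : EuclideanSpace ℝ (Fin 3)) R) :
    (8 * Real.pi) ^ (-(3 : ℝ) / 2) * Real.exp (-R ^ 2 / 4) ≤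
      UnboundedOperators.heatKernel (-t) x := by
  have ht1 : 1 ≤ -t := by linarith [ht.2]
  have ht2 : -t ≤ 2 := by linarith [ht.1]
  have hxR : ‖x‖ < R := mem_ball_zero_iff.1 hx
  unfold UnboundedOperators.heatKernel
  rw [finrank_euclideanSpace_fin]
  have hbase : (4 * Real.pi * (-t)) ^ (-((3 : ℕ) : ℝ) / 2) ≥ (8 * Real.pi) ^ (-(3 : ℝ) / 2) := by
    have h8 : 4 * Real.pi * (-t) ≤ 8 * Real.pi := by nlinarith [Real.pi_pos]
    have hpos : 0 < 4 * Real.pi * (-t) := by positivity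
    have := Real.rpow_le_rpow_of_nonpos hpos h8 (by norm_num : -(3 : ℝ) / 2 ≤ 0)
    simpa using this
  have hexp : Real.exp (-R ^ 2 / 4) ≤ Real.exp (-‖x‖ ^ 2 / (4 * (-t))) := by
    refine Real.exp_le_exp.2 ?_
    rw [neg_div, neg_div, neg_le_neg_iff, div_le_div_iff₀ (by positivity) (by positivity)]
    have hx2 : ‖x‖ ^ 2 ≤ R ^ 2 := by
      have h0 : 0 ≤ ‖x‖ := norm_nonneg _
      nlinarith
    nlinarith [sq_nonneg ‖x‖]
  exact mul_le_mul hbase.le hexp (Real.exp_pos _).le (Real.rpow_nonneg (by positivity) _)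

/-- Positivity of the box constant. [folklore] -/
theorem gkSWR_kernel_lower_pos (R : ℝ) :
    0 < (8 * Real.pi) ^ (-(3 : ℝ) / 2) * Real.exp (-R ^ 2 / 4) := by
  have : 0 < (8 * Real.pi) := by positivity
  exact mul_pos (Real.rpow_pos_of_pos this _) (Real.exp_pos _)

/-! ### Local increments at scale `λ` are bounded by the weighted ones -/

/-- **Local ≤ weighted, at scale `λ`.**  With `m₀ = (8π)^{-3/2}e^{-R²/4}`: on the box
`(−2λ², −λ²) × B_{λR}` the kernel is `≥ λ^{-3} m₀` (parabolic self-similarity of the Gaussian), so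
`∫_{box} ‖u_c − u‖² ≤ (λ³/m₀) ∫_{(−2λ²,−λ²)×ℝ³} ‖u_c − u‖² K`. [folklore] -/
theorem gkSWR_local_le_weighted (u : ℝ → EuclideanSpace ℝ (Fin 3) → EuclideanSpace ℝ (Fin 3))
    (c : ℝ) {R lam : ℝ} (hlam : 0 < lam) :
    ∫⁻ z in Ioo (-2 * lam ^ 2) (-lam ^ 2) ×ˢ Metric.ball (0 : EuclideanSpace ℝ (Fin 3)) (lam * R),
        ‖nsRescale c u z.1 z.2 - u z.1 z.2‖ₑ ^ 2 ≤
      ENNReal.ofReal (lam ^ 3 / ((8 * Real.pi) ^ (-(3 : ℝ) / 2) * Real.exp (-R ^ 2 / 4))) *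
        ∫⁻ z in Ioo (2 * (-lam ^ 2)) (-lam ^ 2) ×ˢ (univ : Set (EuclideanSpace ℝ (Fin 3))),
          ‖nsRescale c u z.1 z.2 - u z.1 z.2‖ₑ ^ 2 *
            ENNReal.ofReal (UnboundedOperators.heatKernel (-z.1) z.2) := by
  set m₀ : ℝ := (8 * Real.pi) ^ (-(3 : ℝ) / 2) * Real.exp (-R ^ 2 / 4) with hm₀
  have hm₀pos : 0 < m₀ := gkSWR_kernel_lower_pos R
  have hl3 : 0 < lam ^ 3 := pow_pos hlam 3
  have hbox : MeasurableSet (Ioo (-2 * lam ^ 2) (-lam ^ 2) ×ˢ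
      Metric.ball (0 : EuclideanSpace ℝ (Fin 3)) (lam * R)) :=
    measurableSet_Ioo.prod measurableSet_ball
  -- the kernel bound on the box
  have hK : ∀ z ∈ Ioo (-2 * lam ^ 2) (-lam ^ 2) ×ˢ Metric.ball (0 : EuclideanSpace ℝ (Fin 3)) (lam * R),
      m₀ / lam ^ 3 ≤ UnboundedOperators.heatKernel (-z.1) z.2 := by
    intro z hz
    obtain ⟨hz1, hz2⟩ := mem_prod.1 hz
    -- normalised coordinates
    set t' : ℝ := z.1 / lam ^ 2 with ht'
    set x' : EuclideanSpace ℝ (Fin 3) := lam⁻¹ • z.2 with hx'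
    have hl2 : 0 < lam ^ 2 := pow_pos hlam 2
    have ht'mem : t' ∈ Ioo (-2 : ℝ) (-1) := by
      constructor
      · rw [ht', lt_div_iff₀ hl2]; linarith [hz1.1]
      · rw [ht', div_lt_iff₀ hl2]; linarith [hz1.2]
    have hx'mem : x' ∈ Metric.ball (0 : EuclideanSpace ℝ (Fin 3)) R := by
      rw [mem_ball_zero_iff] at hz2 ⊢
      rw [hx', norm_smul, norm_inv, Real.norm_of_nonneg hlam.le, inv_mul_lt_iff₀ hlam]
      exact hz2
    have hzt : -z.1 = lam ^ 2 * (-t') := by rw [ht']; field_simp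
    have hzx : z.2 = lam • x' := by rw [hx', smul_inv_smul₀ hlam.ne']
    have ht'pos : 0 < -t' := by linarith [ht'mem.2]
    rw [hzt, hzx, heatKernel_sq_mul_smul hlam ht'pos, finrank_euclideanSpace_fin,
      div_eq_mul_inv, mul_comm]
    exact mul_le_mul_of_nonneg_left (gkSWR_kernel_lower ht'mem hx'mem) (inv_pos.2 hl3).le
  -- pointwise: `f ≤ (λ³/m₀) (f K)` on the box
  calc ∫⁻ z in Ioo (-2 * lam ^ 2) (-lam ^ 2) ×ˢ Metric.ball (0 : EuclideanSpace ℝ (Fin 3)) (lam * R),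
        ‖nsRescale c u z.1 z.2 - u z.1 z.2‖ₑ ^ 2
      ≤ ∫⁻ z in Ioo (-2 * lam ^ 2) (-lam ^ 2) ×ˢ Metric.ball (0 : EuclideanSpace ℝ (Fin 3)) (lam * R),
        ENNReal.ofReal (lam ^ 3 / m₀) * (‖nsRescale c u z.1 z.2 - u z.1 z.2‖ₑ ^ 2 *
          ENNReal.ofReal (UnboundedOperators.heatKernel (-z.1) z.2)) := by
        refine lintegral_mono_ae ((ae_restrict_mem hbox).mono fun z hz => ?_)
        have h1 : 1 ≤ ENNReal.ofReal (lam ^ 3 / m₀) *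
            ENNReal.ofReal (UnboundedOperators.heatKernel (-z.1) z.2) := by
          rw [← ENNReal.ofReal_mul (by positivity), ← ENNReal.ofReal_one]
          refine ENNReal.ofReal_le_ofReal ?_
          have h := mul_le_mul_of_nonneg_left (hK z hz) (by positivity : (0 : ℝ) ≤ lam ^ 3 / m₀)
          rwa [div_mul_div_cancel₀ hm₀pos.ne', div_self hl3.ne'] at h
        calc ‖nsRescale c u z.1 z.2 - u z.1 z.2‖ₑ ^ 2
            = ‖nsRescale c u z.1 z.2 - u z.1 z.2‖ₑ ^ 2 * 1 := (mul_one _).symm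
          _ ≤ ‖nsRescale c u z.1 z.2 - u z.1 z.2‖ₑ ^ 2 * (ENNReal.ofReal (lam ^ 3 / m₀) *
              ENNReal.ofReal (UnboundedOperators.heatKernel (-z.1) z.2)) := by gcongr
          _ = _ := by ring
    _ = ENNReal.ofReal (lam ^ 3 / m₀) *
        ∫⁻ z in Ioo (-2 * lam ^ 2) (-lam ^ 2) ×ˢ Metric.ball (0 : EuclideanSpace ℝ (Fin 3)) (lam * R),
          ‖nsRescale c u z.1 z.2 - u z.1 z.2‖ₑ ^ 2 *
            ENNReal.ofReal (UnboundedOperators.heatKernel (-z.1) z.2) :=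
        lintegral_const_mul' _ _ ENNReal.ofReal_ne_top
    _ ≤ _ := by
        refine mul_le_mul' le_rfl (lintegral_mono_set (prod_mono ?_ (subset_univ _)))
        intro s hs
        exact ⟨by linarith [hs.1], hs.2⟩


/-! ### Registered tools stub -/

/-- **Registered tools stub** `stub_gkActionTools` (crux stmt-NavierStokesRegularity-1589, line
Sketch v6): the weighted-increment-vs-action bound (from S2a, S2b as hypotheses) and the
local-vs-weighted bound at scale `λ`. [cite: GigaKohn1985, §2] -/
theorem stub_gkActionTools :
    (∀ (hS2a : ∀ (u : ℝ → EuclideanSpace ℝ (Fin 3) → EuclideanSpace ℝ (Fin 3)),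
        ContDiffOn ℝ 1 (uncurry u) (Iio (0 : ℝ) ×ˢ univ) →
        ∀ (t : ℝ), t < 0 → ∀ (x : EuclideanSpace ℝ (Fin 3)) (c : ℝ), 1 ≤ c →
          ‖nsRescale c u t x - u t x‖ₑ ^ 2 ≤
            ENNReal.ofReal (c - 1) * ∫⁻ ς in Icc (1 : ℝ) c,
              ‖u (ς ^ 2 * t) (ς • x) +
                fderiv ℝ (uncurry u) (ς ^ 2 * t, ς • x) (2 * (ς ^ 2 * t), ς • x)‖ₑ ^ 2)
      (hS2b : ∀ (F : ℝ × EuclideanSpace ℝ (Fin 3) → ℝ≥0∞), ContinuousOn F (Iio (0 : ℝ) ×ˢ univ) →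
        ∀ (t₀ : ℝ), t₀ < 0 → ∀ c : ℝ, 1 ≤ c → c ^ 2 ≤ 2 →
          ∫⁻ z in Ioo (2 * t₀) t₀ ×ˢ (univ : Set (EuclideanSpace ℝ (Fin 3))),
              (∫⁻ ς in Icc (1 : ℝ) c, F (ς ^ 2 * z.1, ς • z.2)) *
                ENNReal.ofReal (UnboundedOperators.heatKernel (-z.1) z.2) ≤
            ENNReal.ofReal (c - 1) *
              ∫⁻ z in Ioo (4 * t₀) t₀ ×ˢ (univ : Set (EuclideanSpace ℝ (Fin 3))),
                F z * ENNReal.ofReal (UnboundedOperators.heatKernel (-z.1) z.2))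
      (u : ℝ → EuclideanSpace ℝ (Fin 3) → EuclideanSpace ℝ (Fin 3)),
      ContDiffOn ℝ 1 (uncurry u) (Iio (0 : ℝ) ×ˢ univ) → ∀ (t₀ : ℝ), t₀ < 0 →
      ∀ (c : ℝ), 1 ≤ c → c ^ 2 ≤ 2 →
        ∫⁻ z in Ioo (2 * t₀) t₀ ×ˢ (univ : Set (EuclideanSpace ℝ (Fin 3))),
            ‖nsRescale c u z.1 z.2 - u z.1 z.2‖ₑ ^ 2 *
              ENNReal.ofReal (UnboundedOperators.heatKernel (-z.1) z.2) ≤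
          ∫⁻ z in Ioo (4 * t₀) t₀ ×ˢ (univ : Set (EuclideanSpace ℝ (Fin 3))),
            ‖(2 : ℝ)⁻¹ • u z.1 z.2 + fderiv ℝ (uncurry u) z (z.1, (2 : ℝ)⁻¹ • z.2)‖ₑ ^ 2 *
              ENNReal.ofReal (UnboundedOperators.heatKernel (-z.1) z.2)) ∧
    (∀ (u : ℝ → EuclideanSpace ℝ (Fin 3) → EuclideanSpace ℝ (Fin 3)) (c R lam : ℝ), 0 < lam →
      ∫⁻ z in Ioo (-2 * lam ^ 2) (-lam ^ 2) ×ˢ Metric.ball (0 : EuclideanSpace ℝ (Fin 3)) (lam * R),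
          ‖nsRescale c u z.1 z.2 - u z.1 z.2‖ₑ ^ 2 ≤
        ENNReal.ofReal (lam ^ 3 / ((8 * Real.pi) ^ (-(3 : ℝ) / 2) * Real.exp (-R ^ 2 / 4))) *
          ∫⁻ z in Ioo (2 * (-lam ^ 2)) (-lam ^ 2) ×ˢ (univ : Set (EuclideanSpace ℝ (Fin 3))),
            ‖nsRescale c u z.1 z.2 - u z.1 z.2‖ₑ ^ 2 *
              ENNReal.ofReal (UnboundedOperators.heatKernel (-z.1) z.2)) :=
  ⟨fun hS2a hS2b _ hsm _ ht₀ _ hc1 hc2 => gkSWR_weighted_le_action_of hS2a hS2b hsm ht₀ hc1 hc2,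
    fun u c _ _ hlam => gkSWR_local_le_weighted u c hlam⟩

end Summit.NavierStokesRegularity.NavierStokesRegularity.Theorems

end
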